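import Mathlib
import Summits.ValiantsHypothesis.ValiantsHypothesis.Theses.LiouvilleSarnak
import Summits.ValiantsHypothesis.ValiantsHypothesis.Theorems.LiouvilleSarnakLiouvilleCutRankSwapStability

/-!
# Route LiouvilleSarnak — crux `DigitalBilinearLiouville` (stmt-ValiantsHypothesis-14774):
# SWAP STABILITY of the digital bilinear bound — one row/column swap costs at most a factor `16`

The crux asks `|Σ_{r,c} u(r) w(c) λ(N_π(r,c)+1)|² ≤ ε 4^n ‖u‖² ‖w‖²` for EVERY balanced cut `π` (operator norm
`o(2^n)`).  Companion of `…LiouvilleCutRank.SwapStability` (rank changes by a factor `≤ 4` per swap), for the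
bilinear form and ANY entry function `g` of the bit vector:

* `sum_ite_update` — re-indexing `Σ_{c : c j = x} F(c) = Σ_{c' : c' j = y} F(c'[j ↦ x])`;
  `norm_sq_add_four_le` — `‖a+b+c+d‖² ≤ 16 t` if each square norm is `≤ t`.
* ★ `bilinear_swap_eq` — after exchanging the roles of row bit `i` and column bit `j`
  (`π' = swap(inl i, inr j) ∘ π`), `B_{π'}(u, w) = Σ_{x,y ∈ {0,1}} B_π(u_{xy}, w_{xy})` with the RESTRICTED-SHIFTED
  test vectors `u_{xy}(r) = [r i = x] u(r[i ↦ y])`, `w_{xy}(c) = [c j = y] w(c[j ↦ x])`, of norms `≤ ‖u‖, ‖w‖`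
  (`norm_sq_sum_restrictShift_le`).
* ★ `bilinear_sq_le_of_swap` — hence a bound `|B_π(u,w)|² ≤ K ‖u‖² ‖w‖²` for all `u, w` gives
  `|B_{π'}(u,w)|² ≤ 16 K ‖u‖² ‖w‖²` for all `u, w`; `bilinear_sq_le_of_swaps` — `d` swaps cost `16^d`.
* `eventually_bilinear_of_swaps` — CLASS CLOSURE: if a family of cuts satisfies the digital bilinear bound
  uniformly (`∀ ε > 0 ∃ n₀ ∀ n ≥ n₀ ∀ π, P n π → ∀ u w, |B_π(u,w)|² ≤ ε 4^n ‖u‖²‖w‖²`), then so does the family of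
  cuts obtained from it by `≤ d` swaps (use `ε / 16^d`).

Honest framing: structural only.  Unlike the rank crux, NO cut family is presently known to satisfy the
bilinear bound (even the aligned Type-II statement is open; `AlignedTypeI` is the Type-I case), so today the
content is on the counterexample side: a family of cuts violating the bound with `δ` survives `d` letter
exchanges per level with `δ/16^d`; and any future base class is automatically Hamming-robust.
`DigitalBilinearLiouville`, `LiouvilleCutRank`, `AlgebraicSarnak` stay OPEN; nothing bears on `VP ≠ VNP`.
No definitions.
-/

set_option linter.dupNamespace false

noncomputable section

namespace Summit.ValiantsHypothesis.ValiantsHypothesis.Theorems.LiouvilleSarnakDigitalBilinearLiouville.SwapStability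

open ArithmeticFunction Finset

open Summit.ValiantsHypothesis.ValiantsHypothesis.Theorems.LiouvilleSarnakLiouvilleCutRank.SwapStability
  (elim_swap)

/-! ### §1 Re-indexing along one bit, and a four-term norm bound -/

/-- `Σ_{c : c j = x} F(c) = Σ_{c' : c' j = y} F(c'[j ↦ x])` (the bijection `c ↦ c[j ↦ y]`). [folklore] -/
theorem sum_ite_update {n : ℕ} {M : Type*} [AddCommMonoid M] (j : Fin n) (x y : Bool)
    (F : (Fin n → Bool) → M) :
    (∑ c : Fin n → Bool, if c j = x then F c else 0) =
      ∑ c : Fin n → Bool, if c j = y then F (Function.update c j x) else 0 := by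
  classical
  rw [← Finset.sum_filter, ← Finset.sum_filter]
  refine Finset.sum_nbij' (fun c => Function.update c j y) (fun c => Function.update c j x)
    ?_ ?_ ?_ ?_ ?_
  · intro c _; simp
  · intro c _; simp
  · intro c hc
    simp only [Finset.mem_filter, Finset.mem_univ, true_and] at hc
    rw [Function.update_idem, ← hc, Function.update_eq_self]
  · intro c hc
    simp only [Finset.mem_filter, Finset.mem_univ, true_and] at hc
    rw [Function.update_idem, ← hc, Function.update_eq_self]
  · intro c hc
    simp only [Finset.mem_filter, Finset.mem_univ, true_and] at hc
    rw [Function.update_idem, ← hc, Function.update_eq_self]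

/-- The restricted-shifted test vector has norm at most that of the original:
`Σ_r ‖[r i = x] u(r[i ↦ y])‖² = Σ_{r : r i = y} ‖u r‖² ≤ Σ_r ‖u r‖²`. [folklore] -/
theorem norm_sq_sum_restrictShift_le {n : ℕ} (i : Fin n) (x y : Bool) (u : (Fin n → Bool) → ℂ) :
    (∑ r : Fin n → Bool, ‖(if r i = x then u (Function.update r i y) else 0)‖ ^ 2) ≤
      ∑ r : Fin n → Bool, ‖u r‖ ^ 2 := by
  classical
  have h1 : (∑ r : Fin n → Bool, ‖(if r i = x then u (Function.update r i y) else 0)‖ ^ 2) =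
      ∑ r : Fin n → Bool, if r i = x then ‖u (Function.update r i y)‖ ^ 2 else 0 := by
    refine Finset.sum_congr rfl fun r _ => ?_
    split_ifs <;> simp
  rw [h1, ← sum_ite_update i y x (fun r => ‖u r‖ ^ 2)]
  refine Finset.sum_le_sum fun r _ => ?_
  split_ifs
  · exact le_rfl
  · positivity

/-- `‖(a + b) + (c + d)‖² ≤ 16 t` when each of `‖a‖², ‖b‖², ‖c‖², ‖d‖²` is `≤ t`. [folklore] -/
theorem norm_sq_add_four_le {a b c d : ℂ} {t : ℝ} (ha : ‖a‖ ^ 2 ≤ t) (hb : ‖b‖ ^ 2 ≤ t)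
    (hc : ‖c‖ ^ 2 ≤ t) (hd : ‖d‖ ^ 2 ≤ t) : ‖(a + b) + (c + d)‖ ^ 2 ≤ 16 * t := by
  have ht : 0 ≤ t := (sq_nonneg ‖a‖).trans ha
  have hs : ∀ e : ℂ, ‖e‖ ^ 2 ≤ t → ‖e‖ ≤ Real.sqrt t := fun e he => by
    rw [← Real.sqrt_sq (norm_nonneg e)]; exact Real.sqrt_le_sqrt he
  have hsum : ‖(a + b) + (c + d)‖ ≤ 4 * Real.sqrt t := by
    have := (norm_add_le (a + b) (c + d)).trans (add_le_add (norm_add_le a b) (norm_add_le c d))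
    linarith [hs a ha, hs b hb, hs c hc, hs d hd]
  calc ‖(a + b) + (c + d)‖ ^ 2 ≤ (4 * Real.sqrt t) ^ 2 := pow_le_pow_left₀ (norm_nonneg _) hsum 2
    _ = 16 * t := by rw [mul_pow, Real.sq_sqrt ht]; ring

/-! ### §2 The bilinear form after a swap -/

/-- ★ **The bilinear form of the swapped cut is a sum of four bilinear forms of the original cut** evaluated
at restricted-shifted test vectors. [this file] -/
theorem bilinear_swap_eq {n : ℕ} (g : (Fin (2 * n) → Bool) → ℂ) (π : Fin n ⊕ Fin n ≃ Fin (2 * n))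
    (i j : Fin n) (u w : (Fin n → Bool) → ℂ) :
    (∑ r : Fin n → Bool, ∑ c : Fin n → Bool, u r * w c *
        g (fun k => Sum.elim r c (((Equiv.swap (Sum.inl i) (Sum.inr j)).trans π).symm k))) =
      ∑ x : Bool, ∑ y : Bool, ∑ r : Fin n → Bool, ∑ c : Fin n → Bool,
        (if r i = x then u (Function.update r i y) else 0) *
          (if c j = y then w (Function.update c j x) else 0) *
          g (fun k => Sum.elim r c (π.symm k)) := by
  classical
  set G : (Fin n → Bool) → (Fin n → Bool) → ℂ := fun r c => g (fun k => Sum.elim r c (π.symm k)) with hG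
  have hentry : ∀ r c : Fin n → Bool,
      g (fun k => Sum.elim r c (((Equiv.swap (Sum.inl i) (Sum.inr j)).trans π).symm k)) =
        G (Function.update r i (c j)) (Function.update c j (r i)) := by
    intro r c
    simp only [hG, Equiv.symm_trans_apply, Equiv.symm_swap, elim_swap]
  -- the four pieces, before (`A`) and after (`S`) re-indexing
  set A : Bool → Bool → (Fin n → Bool) → (Fin n → Bool) → ℂ := fun x y r c =>
    (if r i = y then u r else 0) * (if c j = x then w c else 0) *
      G (Function.update r i x) (Function.update c j y) with hA
  set S : Bool → Bool → ℂ := fun x y => ∑ r : Fin n → Bool, ∑ c : Fin n → Bool,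
    (if r i = x then u (Function.update r i y) else 0) *
      (if c j = y then w (Function.update c j x) else 0) * G r c with hS
  have hsplit : ∀ r c : Fin n → Bool,
      u r * w c * G (Function.update r i (c j)) (Function.update c j (r i)) =
        (A false false r c + A false true r c) + (A true false r c + A true true r c) := by
    intro r c
    simp only [hA]
    cases r i <;> cases c j <;> simp
  -- re-indexing: `Σ_{r,c} A x y r c = S x y`
  have hreindex : ∀ x y : Bool, (∑ r : Fin n → Bool, ∑ c : Fin n → Bool, A x y r c) = S x y := by
    intro x y
    simp only [hA, hS]
    -- inner re-indexing in `c`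
    have hc : ∀ r : Fin n → Bool,
        (∑ c : Fin n → Bool, (if r i = y then u r else 0) * (if c j = x then w c else 0) *
          G (Function.update r i x) (Function.update c j y)) =
        ∑ c : Fin n → Bool, (if r i = y then u r else 0) * (if c j = y then w (Function.update c j x) else 0) *
          G (Function.update r i x) c := by
      intro r
      have key := sum_ite_update j x y
        (fun c => (if r i = y then u r else 0) * w c * G (Function.update r i x) (Function.update c j y))
      have e1 : (∑ c : Fin n → Bool, (if r i = y then u r else 0) * (if c j = x then w c else 0) *
          G (Function.update r i x) (Function.update c j y)) =
          ∑ c : Fin n → Bool, (if c j = x then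
            (if r i = y then u r else 0) * w c * G (Function.update r i x) (Function.update c j y) else 0) := by
        refine Finset.sum_congr rfl fun c _ => ?_
        split_ifs <;> simp
      have e2 : (∑ c : Fin n → Bool, (if r i = y then u r else 0) *
          (if c j = y then w (Function.update c j x) else 0) * G (Function.update r i x) c) =
          ∑ c : Fin n → Bool, (if c j = y then
            (if r i = y then u r else 0) * w (Function.update c j x) *
              G (Function.update r i x) (Function.update (Function.update c j x) j y) else 0) := by
        refine Finset.sum_congr rfl fun c _ => ?_
        by_cases h : c j = y
        · rw [if_pos h, if_pos h, Function.update_idem, ← h, Function.update_eq_self]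
        · rw [if_neg h, if_neg h]; simp
      rw [e1, e2, key]
    simp_rw [hc]
    -- outer re-indexing in `r`, column by column
    rw [Finset.sum_comm]
    conv_rhs => rw [Finset.sum_comm]
    refine Finset.sum_congr rfl fun c _ => ?_
    have key := sum_ite_update i y x
      (fun r => u r * (if c j = y then w (Function.update c j x) else 0) * G (Function.update r i x) c)
    have e1 : (∑ r : Fin n → Bool, (if r i = y then u r else 0) *
        (if c j = y then w (Function.update c j x) else 0) * G (Function.update r i x) c) =
        ∑ r : Fin n → Bool, (if r i = y then
          u r * (if c j = y then w (Function.update c j x) else 0) * G (Function.update r i x) c else 0) := by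
      refine Finset.sum_congr rfl fun r _ => ?_
      split_ifs <;> simp
    have e2 : (∑ r : Fin n → Bool, (if r i = x then u (Function.update r i y) else 0) *
        (if c j = y then w (Function.update c j x) else 0) * G r c) =
        ∑ r : Fin n → Bool, (if r i = x then
          u (Function.update r i y) * (if c j = y then w (Function.update c j x) else 0) *
            G (Function.update (Function.update r i y) i x) c else 0) := by
      refine Finset.sum_congr rfl fun r _ => ?_
      by_cases h : r i = x
      · rw [if_pos h, if_pos h, Function.update_idem, ← h, Function.update_eq_self]
      · rw [if_neg h, if_neg h]; simp
    rw [e1, e2, key]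
  -- assemble
  have hL : (∑ r : Fin n → Bool, ∑ c : Fin n → Bool, u r * w c *
        g (fun k => Sum.elim r c (((Equiv.swap (Sum.inl i) (Sum.inr j)).trans π).symm k))) =
      ((∑ r : Fin n → Bool, ∑ c : Fin n → Bool, A false false r c) +
        (∑ r : Fin n → Bool, ∑ c : Fin n → Bool, A false true r c)) +
      ((∑ r : Fin n → Bool, ∑ c : Fin n → Bool, A true false r c) +
        (∑ r : Fin n → Bool, ∑ c : Fin n → Bool, A true true r c)) := by
    simp_rw [hentry, hsplit, Finset.sum_add_distrib]
  have hR : (∑ x : Bool, ∑ y : Bool, S x y) = (S false false + S false true) + (S true false + S true true) := by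
    simp only [Fintype.sum_bool]; ring
  rw [hL, hreindex, hreindex, hreindex, hreindex]
  exact hR.symm

/-! ### §3 Consequences for uniform bilinear bounds -/

/-- ★ **One swap costs a factor `16`.**  If `|B_π(u,w)|² ≤ K ‖u‖² ‖w‖²` for all test vectors, then
`|B_{π'}(u,w)|² ≤ 16 K ‖u‖² ‖w‖²` for the swapped cut `π'`. [this file] -/
theorem bilinear_sq_le_of_swap {n : ℕ} (g : (Fin (2 * n) → Bool) → ℂ) (π : Fin n ⊕ Fin n ≃ Fin (2 * n))
    (i j : Fin n) (K : ℝ) (hK : 0 ≤ K)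
    (h : ∀ u w : (Fin n → Bool) → ℂ,
      ‖∑ r : Fin n → Bool, ∑ c : Fin n → Bool, u r * w c * g (fun k => Sum.elim r c (π.symm k))‖ ^ 2 ≤
        K * (∑ r : Fin n → Bool, ‖u r‖ ^ 2) * (∑ c : Fin n → Bool, ‖w c‖ ^ 2))
    (u w : (Fin n → Bool) → ℂ) :
    ‖∑ r : Fin n → Bool, ∑ c : Fin n → Bool, u r * w c *
        g (fun k => Sum.elim r c (((Equiv.swap (Sum.inl i) (Sum.inr j)).trans π).symm k))‖ ^ 2 ≤
      16 * K * (∑ r : Fin n → Bool, ‖u r‖ ^ 2) * (∑ c : Fin n → Bool, ‖w c‖ ^ 2) := by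
  rw [bilinear_swap_eq]
  simp only [Fintype.sum_bool]
  set U : ℝ := ∑ r : Fin n → Bool, ‖u r‖ ^ 2 with hU
  set V : ℝ := ∑ c : Fin n → Bool, ‖w c‖ ^ 2 with hV
  have hU0 : 0 ≤ U := Finset.sum_nonneg fun _ _ => by positivity
  -- each of the four terms is bounded by `K U V` in square
  have hTle : ∀ x y : Bool, ‖∑ r : Fin n → Bool, ∑ c : Fin n → Bool,
      (if r i = x then u (Function.update r i y) else 0) *
        (if c j = y then w (Function.update c j x) else 0) * g (fun k => Sum.elim r c (π.symm k))‖ ^ 2 ≤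
      K * U * V := by
    intro x y
    refine (h _ _).trans ?_
    have h1 := norm_sq_sum_restrictShift_le i x y u
    have h2 := norm_sq_sum_restrictShift_le j y x w
    exact mul_le_mul (mul_le_mul_of_nonneg_left h1 hK) h2
      (Finset.sum_nonneg fun _ _ => by positivity) (mul_nonneg hK hU0)
  have := norm_sq_add_four_le (hTle true true) (hTle true false) (hTle false true) (hTle false false)
  linarith [this]

/-- **`d` swaps cost `16^d`.** [this file] -/
theorem bilinear_sq_le_of_swaps {n : ℕ} (g : (Fin (2 * n) → Bool) → ℂ) (π : Fin n ⊕ Fin n ≃ Fin (2 * n))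
    (L : List (Fin n × Fin n)) (K : ℝ) (hK : 0 ≤ K)
    (h : ∀ u w : (Fin n → Bool) → ℂ,
      ‖∑ r : Fin n → Bool, ∑ c : Fin n → Bool, u r * w c * g (fun k => Sum.elim r c (π.symm k))‖ ^ 2 ≤
        K * (∑ r : Fin n → Bool, ‖u r‖ ^ 2) * (∑ c : Fin n → Bool, ‖w c‖ ^ 2))
    (u w : (Fin n → Bool) → ℂ) :
    ‖∑ r : Fin n → Bool, ∑ c : Fin n → Bool, u r * w c * g (fun k => Sum.elim r c
        ((L.foldr (fun q e => (Equiv.swap (Sum.inl q.1) (Sum.inr q.2)).trans e) π).symm k))‖ ^ 2 ≤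
      16 ^ L.length * K * (∑ r : Fin n → Bool, ‖u r‖ ^ 2) * (∑ c : Fin n → Bool, ‖w c‖ ^ 2) := by
  induction L generalizing u w with
  | nil => simpa using h u w
  | cons q L ih =>
    rw [List.foldr_cons, List.length_cons, pow_succ]
    have h16 : (0 : ℝ) ≤ 16 ^ L.length * K := by positivity
    have := bilinear_sq_le_of_swap g
      (L.foldr (fun q e => (Equiv.swap (Sum.inl q.1) (Sum.inr q.2)).trans e) π) q.1 q.2
      (16 ^ L.length * K) h16 (fun u' w' => ih u' w') u w
    calc _ ≤ 16 * (16 ^ L.length * K) * (∑ r : Fin n → Bool, ‖u r‖ ^ 2) *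
          (∑ c : Fin n → Bool, ‖w c‖ ^ 2) := this
      _ = 16 ^ L.length * 16 * K * (∑ r : Fin n → Bool, ‖u r‖ ^ 2) *
          (∑ c : Fin n → Bool, ‖w c‖ ^ 2) := by ring

/-- ★ **Class closure for the digital bilinear bound.**  If the cuts with a property `P` satisfy the bound
of `DigitalBilinearLiouville` uniformly, then so do all cuts obtained from them by at most `d` row/column
swaps (`d` fixed). [this file] -/
theorem eventually_bilinear_of_swaps
    (P : ∀ n : ℕ, (Fin n ⊕ Fin n ≃ Fin (2 * n)) → Prop)
    (h : ∀ ε : ℝ, 0 < ε → ∃ n₀ : ℕ, ∀ n ≥ n₀, ∀ π : Fin n ⊕ Fin n ≃ Fin (2 * n), P n π →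
      ∀ u w : (Fin n → Bool) → ℂ,
        ‖∑ r : Fin n → Bool, ∑ c : Fin n → Bool, u r * w c *
          ((liouville (Nat.ofBits (fun k : Fin (2 * n) => Sum.elim r c (π.symm k)) + 1) : ℤ) : ℂ)‖ ^ 2 ≤
        ε * 4 ^ n * (∑ r : Fin n → Bool, ‖u r‖ ^ 2) * (∑ c : Fin n → Bool, ‖w c‖ ^ 2))
    (d : ℕ) (ε : ℝ) (hε : 0 < ε) : ∃ n₀ : ℕ, ∀ n ≥ n₀, ∀ π : Fin n ⊕ Fin n ≃ Fin (2 * n), P n π →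
      ∀ L : List (Fin n × Fin n), L.length ≤ d → ∀ u w : (Fin n → Bool) → ℂ,
        ‖∑ r : Fin n → Bool, ∑ c : Fin n → Bool, u r * w c *
          ((liouville (Nat.ofBits (fun k : Fin (2 * n) => Sum.elim r c
            ((L.foldr (fun q e => (Equiv.swap (Sum.inl q.1) (Sum.inr q.2)).trans e) π).symm k)) + 1) :
              ℤ) : ℂ)‖ ^ 2 ≤
        ε * 4 ^ n * (∑ r : Fin n → Bool, ‖u r‖ ^ 2) * (∑ c : Fin n → Bool, ‖w c‖ ^ 2) := by
  have hε' : 0 < ε / 16 ^ d := by positivity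
  obtain ⟨n₀, hn₀⟩ := h (ε / 16 ^ d) hε'
  refine ⟨n₀, fun n hn π hP L hL u w => ?_⟩
  have hK : (0 : ℝ) ≤ ε / 16 ^ d * 4 ^ n := by positivity
  have hbase : ∀ u w : (Fin n → Bool) → ℂ,
      ‖∑ r : Fin n → Bool, ∑ c : Fin n → Bool, u r * w c *
        (fun v : Fin (2 * n) → Bool => (((liouville (Nat.ofBits v + 1)) : ℤ) : ℂ))
          (fun k => Sum.elim r c (π.symm k))‖ ^ 2 ≤
        ε / 16 ^ d * 4 ^ n * (∑ r : Fin n → Bool, ‖u r‖ ^ 2) * (∑ c : Fin n → Bool, ‖w c‖ ^ 2) :=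
    fun u w => hn₀ n hn π hP u w
  have := bilinear_sq_le_of_swaps
    (fun v : Fin (2 * n) → Bool => (((liouville (Nat.ofBits v + 1)) : ℤ) : ℂ)) π L
    (ε / 16 ^ d * 4 ^ n) hK hbase u w
  refine this.trans ?_
  have hU0 : 0 ≤ ∑ r : Fin n → Bool, ‖u r‖ ^ 2 := Finset.sum_nonneg fun _ _ => by positivity
  have hV0 : 0 ≤ ∑ c : Fin n → Bool, ‖w c‖ ^ 2 := Finset.sum_nonneg fun _ _ => by positivity
  have h16 : (16 : ℝ) ^ L.length ≤ 16 ^ d := pow_le_pow_right₀ (by norm_num) hL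
  have hpos : (0 : ℝ) < 16 ^ d := by positivity
  have key : 16 ^ L.length * (ε / 16 ^ d * 4 ^ n) ≤ ε * 4 ^ n := by
    calc 16 ^ L.length * (ε / 16 ^ d * 4 ^ n) ≤ 16 ^ d * (ε / 16 ^ d * 4 ^ n) :=
          mul_le_mul_of_nonneg_right h16 (by positivity)
      _ = ε * 4 ^ n := by field_simp
  calc 16 ^ L.length * (ε / 16 ^ d * 4 ^ n) * (∑ r : Fin n → Bool, ‖u r‖ ^ 2) *
        (∑ c : Fin n → Bool, ‖w c‖ ^ 2)
      ≤ ε * 4 ^ n * (∑ r : Fin n → Bool, ‖u r‖ ^ 2) * (∑ c : Fin n → Bool, ‖w c‖ ^ 2) :=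
        mul_le_mul_of_nonneg_right (mul_le_mul_of_nonneg_right key hU0) hV0

end Summit.ValiantsHypothesis.ValiantsHypothesis.Theorems.LiouvilleSarnakDigitalBilinearLiouville.SwapStability

end
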